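import Mathlib
import HarnessLib
import Literature.MathematicalPhysics.StatisticalMechanics.AbkmPackageLargeSetMargin
import Literature.MathematicalPhysics.StatisticalMechanics.RenormalisationMapSmallnessGain

/-!
# [ABKM19] — the package conditions `hc3A` / `hc2A` at a SMALLER block-product letter `κ₀ ≤ κ(r)` leave room for a
# LARGER per-block integration constant (`κ₀·max(1,m') ≤ κ(r)·max(1,A_𝒫')`)

The weak-norm conversion of the remainder bounds of `S_k` ([ABKM19] Theorem 6.8; in the tree
`RenormalisationMapLipschitzQ.weakNormLE_nextKStep_sub_abkm_of_stepKernelBounds`) consumes the two counting conditions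
`κ^{L^d}·(2(2κ·max(1,A_𝒫)))^{cL^d}4^{cL^d} ≤ A^{η−1}` (`hc3A`) and `κ^{L^d}·(2κ·max(1,A_𝒫))^{cL^d}2^{cL^d} ≤ A^{η−1}` (`hc2A`)
at the block-product letter `κ` and the per-block integration constant `A_𝒫`.  A package (`PackageData`, `AbkmPackageSlots`)
carries them at `κ = kappaABKM d R A A_𝒫' r = 1 + e^{1/4} + 16e^{3/8}(4r + 2v_r)` and `A_𝒫'`.  The two-kernel comparison of
`S_k` in the tuning parameter (line `banach_two_kernel` of the child `TwoKernelSkBound` of the cruxes `HypACumulant` /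
`HypALocalTwoPoint`, route `Summits/HubbardSuperconductivity/…/Theses/ComplexGFFStiffness`) needs them at a LARGER per-block
constant `m' = max(A_𝒫', κ_p)` (Hölder pair of Lemma 8.4) but only at the SMALLER letter `κ₀ = 1 + e^{1/4} + 16e^{3/8}‖H̃_a − H̃_b‖`
(the large remainders `Σ₂ᴸ, Σ₃, Σ₄` need `κ ≥ 1 + e^{1/4} + Δ` only).  Both left-hand sides are monotone in `(κ, κ·max(1,·))`,
so the package conditions transfer as soon as `κ₀ ≤ κ(r)` and `κ₀·max(1, m') ≤ κ(r)·max(1, A_𝒫')` — the room is the ratio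
`κ(r)/κ₀ = 1 + Θ(r)`:

* `c3Const_mono`, `c2Const_mono` — the real-arithmetic monotonicity;
* **`PackageData.hc3A_of_le`**, **`PackageData.hc2A_of_le`** — the package conditions at `(κ₀, m')`;
* `kappaABKM_eq_mid_add` — `κ(r) = (1 + e^{1/4} + 16e^{3/8}(2r + v_r)) + 16e^{3/8}(2r + v_r)` (the room, explicitly).

Pure real arithmetic; nothing about superconductivity in the Hubbard model.  Everything is proved; no named fact.

## References
* S. Adams, S. Buchholz, R. Kotecký, S. Müller, arXiv:1910.13564 — Theorem 6.8, Ch. 12 (12.4), Lemma 12.6 (12.53)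
  [AdamsBuchholzKoteckyMuller2019].
-/

noncomputable section

namespace Literature.MathematicalPhysics.StatisticalMechanics.GradientRG

variable {d : ℕ}

/-- Monotonicity of the `hc3A` left-hand side `κ^n·((2(2κ·max(1,m)))^N·4^N)` in `κ` and `κ·max(1,m)`.
[cite: AdamsBuchholzKoteckyMuller2019, Theorem 6.8 / Ch. 12 (12.4)] -/
theorem c3Const_mono {κ₀ κA m m' : ℝ} (hκ₀ : 0 ≤ κ₀) (hκ : κ₀ ≤ κA)
    (hmm : κ₀ * max 1 m' ≤ κA * max 1 m) (n N : ℕ) :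
    κ₀ ^ n * ((2 * (2 * κ₀ * max 1 m')) ^ N * (4 : ℝ) ^ N) ≤
      κA ^ n * ((2 * (2 * κA * max 1 m)) ^ N * (4 : ℝ) ^ N) := by
  have h1 : 0 ≤ κ₀ * max 1 m' := mul_nonneg hκ₀ (le_trans zero_le_one (le_max_left _ _))
  have hb : 2 * (2 * κ₀ * max 1 m') ≤ 2 * (2 * κA * max 1 m) := by nlinarith
  have hb0 : 0 ≤ 2 * (2 * κ₀ * max 1 m') := by nlinarith
  have hp1 : κ₀ ^ n ≤ κA ^ n := pow_le_pow_left₀ hκ₀ hκ n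
  have hp2 : (2 * (2 * κ₀ * max 1 m')) ^ N ≤ (2 * (2 * κA * max 1 m)) ^ N := pow_le_pow_left₀ hb0 hb N
  have h4 : (0 : ℝ) ≤ (4 : ℝ) ^ N := by positivity
  exact mul_le_mul hp1 (mul_le_mul_of_nonneg_right hp2 h4) (by positivity) (pow_nonneg (hκ₀.trans hκ) n)

/-- Monotonicity of the `hc2A` left-hand side `κ^n·((2κ·max(1,m))^N·2^N)` in `κ` and `κ·max(1,m)`.
[cite: AdamsBuchholzKoteckyMuller2019, Theorem 6.8 / Ch. 12 (12.4)] -/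
theorem c2Const_mono {κ₀ κA m m' : ℝ} (hκ₀ : 0 ≤ κ₀) (hκ : κ₀ ≤ κA)
    (hmm : κ₀ * max 1 m' ≤ κA * max 1 m) (n N : ℕ) :
    κ₀ ^ n * ((2 * κ₀ * max 1 m') ^ N * (2 : ℝ) ^ N) ≤
      κA ^ n * ((2 * κA * max 1 m) ^ N * (2 : ℝ) ^ N) := by
  have h1 : 0 ≤ κ₀ * max 1 m' := mul_nonneg hκ₀ (le_trans zero_le_one (le_max_left _ _))
  have hb : 2 * κ₀ * max 1 m' ≤ 2 * κA * max 1 m := by nlinarith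
  have hb0 : 0 ≤ 2 * κ₀ * max 1 m' := by nlinarith
  have hp1 : κ₀ ^ n ≤ κA ^ n := pow_le_pow_left₀ hκ₀ hκ n
  have hp2 : (2 * κ₀ * max 1 m') ^ N ≤ (2 * κA * max 1 m) ^ N := pow_le_pow_left₀ hb0 hb N
  have h2 : (0 : ℝ) ≤ (2 : ℝ) ^ N := by positivity
  exact mul_le_mul hp1 (mul_le_mul_of_nonneg_right hp2 h2) (by positivity) (pow_nonneg (hκ₀.trans hκ) n)

/-- If `κ₀ ≤ κ_mid` and `m'·κ_mid ≤ κ_A·m₁` (with `m' ≥ 0`, `κ_mid > 0`) then `κ₀·m' ≤ κ_A·m₁`: the form in which the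
room `κ_A/κ_mid` is spent on the ratio of the per-block constants. [cite: AdamsBuchholzKoteckyMuller2019, Lemma 12.6 (12.53)] -/
theorem mul_le_mul_of_ratio {κ₀ κmid κA m₁ m' : ℝ} (hκ₀ : κ₀ ≤ κmid) (hm' : 0 ≤ m')
    (hroom : m' * κmid ≤ κA * m₁) : κ₀ * m' ≤ κA * m₁ := by
  nlinarith

/-- `κ(r) = kappaABKM d R A A_𝒫 r` splits as `(1 + e^{1/4} + 16e^{3/8}(2r + v_r)) + 16e^{3/8}(2r + v_r)`: the first summand
dominates the block-product letter needed by the remainders as soon as `16e^{3/8}‖H̃_a − H̃_b‖ ≤ 16e^{3/8}(2r + v_r)`, the second is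
the room. [cite: AdamsBuchholzKoteckyMuller2019, Ch. 12 (12.4)] -/
theorem kappaABKM_eq_mid_add (R : ℕ) (A A𝒫 r : ℝ) :
    kappaABKM d R A A𝒫 r =
      (1 + Real.exp (1 / 4) + 16 * Real.exp (3 / 8) * (2 * r + vABKM d R A A𝒫 r)) +
        16 * Real.exp (3 / 8) * (2 * r + vABKM d R A A𝒫 r) := by
  unfold kappaABKM; ring

namespace PackageData

/-- **The package condition `hc3A` at a smaller letter and a larger per-block constant**: for `0 ≤ κ₀ ≤ κ(r)` and
`κ₀·max(1, m') ≤ κ(r)·max(1, A_𝒫')`,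
`κ₀^{L^d}·((2(2κ₀·max(1,m')))^{cL^d}·4^{cL^d}) ≤ A^{η−1}`. [cite: AdamsBuchholzKoteckyMuller2019, Theorem 6.8 / Ch. 12 (12.4)] -/
theorem hc3A_of_le (P : PackageData d) {κ₀ m' : ℝ} (hκ₀ : 0 ≤ κ₀)
    (hκ : κ₀ ≤ kappaABKM d P.R P.A P.A𝒫' P.r)
    (hmm : κ₀ * max 1 m' ≤ kappaABKM d P.R P.A P.A𝒫' P.r * max 1 P.A𝒫') :
    κ₀ ^ (P.L ^ d) * ((2 * (2 * κ₀ * max 1 m')) ^ ((2 ^ (d + 1) + 2) ^ d * P.L ^ d) *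
        (4 : ℝ) ^ ((2 ^ (d + 1) + 2) ^ d * P.L ^ d)) ≤
      P.A ^ ((1 + 1 / ((2 * (2 ^ d + 1) + 6 : ℝ) ^ d)) - 1 : ℝ) :=
  (c3Const_mono hκ₀ hκ hmm _ _).trans P.hc3A

/-- **The package condition `hc2A` at a smaller letter and a larger per-block constant**: for `0 ≤ κ₀ ≤ κ(r)` and
`κ₀·max(1, m') ≤ κ(r)·max(1, A_𝒫')`,
`κ₀^{L^d}·((2κ₀·max(1,m'))^{cL^d}·2^{cL^d}) ≤ A^{η−1}`. [cite: AdamsBuchholzKoteckyMuller2019, Theorem 6.8 / Ch. 12 (12.4)] -/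
theorem hc2A_of_le (P : PackageData d) {κ₀ m' : ℝ} (hκ₀ : 0 ≤ κ₀)
    (hκ : κ₀ ≤ kappaABKM d P.R P.A P.A𝒫' P.r)
    (hmm : κ₀ * max 1 m' ≤ kappaABKM d P.R P.A P.A𝒫' P.r * max 1 P.A𝒫') :
    κ₀ ^ (P.L ^ d) * ((2 * κ₀ * max 1 m') ^ ((2 ^ (d + 1) + 2) ^ d * P.L ^ d) *
        (2 : ℝ) ^ ((2 ^ (d + 1) + 2) ^ d * P.L ^ d)) ≤
      P.A ^ ((1 + 1 / ((2 * (2 ^ d + 1) + 6 : ℝ) ^ d)) - 1 : ℝ) :=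
  (c2Const_mono hκ₀ hκ hmm _ _).trans P.hc2A

end PackageData

/-! ## Geometric room: a strict ratio of the letters gives a factor `λ^u` on top of the gain `A^{−u}` -/

/-- **Ratio form of the `hc3A` monotonicity**: if `0 ≤ κ₀ ≤ κA` and `κ₀·max(1,m') ≤ λ·(κA·max(1,m))` then
`κ₀^n·((2(2κ₀·max(1,m')))^N·4^N) ≤ λ^N · [κA^n·((2(2κA·max(1,m)))^N·4^N)]` — the room `λ^N` (`N = cL^d` per `(k+1)`-block)
that absorbs the polynomial diameter factor of the local pair property. [cite: AdamsBuchholzKoteckyMuller2019, Theorem 6.8 / Ch. 12 (12.4)] -/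
theorem c3Const_ratio {κ₀ κA m m' lam : ℝ} (hκ₀ : 0 ≤ κ₀) (hκ : κ₀ ≤ κA)
    (hmm : κ₀ * max 1 m' ≤ lam * (κA * max 1 m)) (n N : ℕ) :
    κ₀ ^ n * ((2 * (2 * κ₀ * max 1 m')) ^ N * (4 : ℝ) ^ N) ≤
      lam ^ N * (κA ^ n * ((2 * (2 * κA * max 1 m)) ^ N * (4 : ℝ) ^ N)) := by
  have h1 : 0 ≤ κ₀ * max 1 m' := mul_nonneg hκ₀ (le_trans zero_le_one (le_max_left _ _))
  have hb : 2 * (2 * κ₀ * max 1 m') ≤ lam * (2 * (2 * κA * max 1 m)) := by nlinarith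
  have hb0 : 0 ≤ 2 * (2 * κ₀ * max 1 m') := by nlinarith
  have hp1 : κ₀ ^ n ≤ κA ^ n := pow_le_pow_left₀ hκ₀ hκ n
  have hp2 : (2 * (2 * κ₀ * max 1 m')) ^ N ≤ lam ^ N * (2 * (2 * κA * max 1 m)) ^ N := by
    rw [← mul_pow]; exact pow_le_pow_left₀ hb0 hb N
  have hκA0 : 0 ≤ κA := hκ₀.trans hκ
  have hmA : 0 ≤ κA * max 1 m := mul_nonneg hκA0 (le_trans zero_le_one (le_max_left _ _))
  have h4 : (0 : ℝ) ≤ (4 : ℝ) ^ N := by positivity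
  have hq : 0 ≤ (2 * (2 * κA * max 1 m)) ^ N := pow_nonneg (by nlinarith) N
  calc κ₀ ^ n * ((2 * (2 * κ₀ * max 1 m')) ^ N * (4 : ℝ) ^ N)
      ≤ κA ^ n * ((lam ^ N * (2 * (2 * κA * max 1 m)) ^ N) * (4 : ℝ) ^ N) :=
        mul_le_mul hp1 (mul_le_mul_of_nonneg_right hp2 h4) (by positivity) (pow_nonneg hκA0 n)
    _ = lam ^ N * (κA ^ n * ((2 * (2 * κA * max 1 m)) ^ N * (4 : ℝ) ^ N)) := by ring

/-- **Gain with geometric room**: if `c' ≤ λ^N0·c` (`N0 ≥ 1`, `0 ≤ λ ≤ 1`, `0 ≤ c', c`), `c ≤ A^{η−1}` and `A ≥ 1`, then for every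
`n ≥ 1`: `c'^n·A^{−ηn} ≤ λ^n·(A^n)^{−1}` — the remainder gain of Theorem 6.8 with an extra factor `λ^n`.
[cite: AdamsBuchholzKoteckyMuller2019, Theorem 6.8 / Ch. 12 (12.4)] -/
theorem pow_mul_rpow_le_geom_inv_pow {A η c c' lam : ℝ} {N0 : ℕ} (hA : 1 ≤ A) (hc' : 0 ≤ c') (hc0 : 0 ≤ c)
    (hlam : 0 ≤ lam) (hlam1 : lam ≤ 1) (hN0 : 1 ≤ N0) (hcc : c' ≤ lam ^ N0 * c) (hcA : c ≤ A ^ (η - 1 : ℝ))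
    {n : ℕ} (hn : 1 ≤ n) :
    c' ^ n * A ^ (-(η * n) : ℝ) ≤ lam ^ n * (A ^ n)⁻¹ := by
  have hA0 : 0 < A := by linarith
  have hlamN : lam ^ N0 ≤ lam := by
    calc lam ^ N0 ≤ lam ^ 1 := pow_le_pow_of_le_one hlam hlam1 hN0
      _ = lam := pow_one lam
  have hcc' : c' ≤ lam * c := hcc.trans (mul_le_mul_of_nonneg_right hlamN hc0)
  have hpow : c' ^ n ≤ (lam * c) ^ n := pow_le_pow_left₀ hc' hcc' n
  have hrpow : 0 ≤ A ^ (-(η * n) : ℝ) := Real.rpow_nonneg hA0.le _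
  calc c' ^ n * A ^ (-(η * n) : ℝ) ≤ (lam * c) ^ n * A ^ (-(η * n) : ℝ) := mul_le_mul_of_nonneg_right hpow hrpow
    _ = lam ^ n * (c ^ n * A ^ (-(η * n) : ℝ)) := by rw [mul_pow]; ring
    _ ≤ lam ^ n * (A ^ n)⁻¹ :=
        mul_le_mul_of_nonneg_left (TorusPolymer.pow_mul_rpow_le_inv_pow' hA hc0 hcA hn) (pow_nonneg hlam n)

/-- **Ratio form of the `hc2A` monotonicity** (companion of `c3Const_ratio`): if `0 ≤ κ₀ ≤ κA` and
`κ₀·max(1,m') ≤ λ·(κA·max(1,m))`, then `κ₀^n·((2κ₀·max(1,m'))^N·2^N) ≤ λ^N·[κA^n·((2κA·max(1,m))^N·2^N)]`.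
[cite: AdamsBuchholzKoteckyMuller2019, Theorem 6.8 / Ch. 12 (12.4)] -/
theorem c2Const_ratio {κ₀ κA m m' lam : ℝ} (hκ₀ : 0 ≤ κ₀) (hκ : κ₀ ≤ κA)
    (hmm : κ₀ * max 1 m' ≤ lam * (κA * max 1 m)) (n N : ℕ) :
    κ₀ ^ n * ((2 * κ₀ * max 1 m') ^ N * (2 : ℝ) ^ N) ≤
      lam ^ N * (κA ^ n * ((2 * κA * max 1 m) ^ N * (2 : ℝ) ^ N)) := by
  have h1 : 0 ≤ κ₀ * max 1 m' := mul_nonneg hκ₀ (le_trans zero_le_one (le_max_left _ _))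
  have hb : 2 * κ₀ * max 1 m' ≤ lam * (2 * κA * max 1 m) := by nlinarith
  have hb0 : 0 ≤ 2 * κ₀ * max 1 m' := by nlinarith
  have hp1 : κ₀ ^ n ≤ κA ^ n := pow_le_pow_left₀ hκ₀ hκ n
  have hp2 : (2 * κ₀ * max 1 m') ^ N ≤ lam ^ N * (2 * κA * max 1 m) ^ N := by
    rw [← mul_pow]; exact pow_le_pow_left₀ hb0 hb N
  have hκA0 : 0 ≤ κA := hκ₀.trans hκ
  have h2 : (0 : ℝ) ≤ (2 : ℝ) ^ N := by positivity
  calc κ₀ ^ n * ((2 * κ₀ * max 1 m') ^ N * (2 : ℝ) ^ N)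
      ≤ κA ^ n * ((lam ^ N * (2 * κA * max 1 m) ^ N) * (2 : ℝ) ^ N) :=
        mul_le_mul hp1 (mul_le_mul_of_nonneg_right hp2 h2) (by positivity) (pow_nonneg hκA0 n)
    _ = lam ^ N * (κA ^ n * ((2 * κA * max 1 m) ^ N * (2 : ℝ) ^ N)) := by ring

end Literature.MathematicalPhysics.StatisticalMechanics.GradientRG

end
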